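import Literature.MathematicalPhysics.QuantumManyBody.BoseGasHardLayer
import Literature.MathematicalPhysics.QuantumManyBody.PeriodicConfigFourier
import HarnessLib

/-!
# Hard layers along coordinate lines: periodicity, measurability, line parametrisation

Topic `Literature/MathematicalPhysics/QuantumManyBody`, sequel of `BoseGasHardLayer.lean` and `PeriodicConfigFourier.lean`.
Bookkeeping for the line-wise analysis of finite-energy periodic `N`-body functions near the hard configurations of a
pair potential (form-core theorem for hard cores): how the pair-image radii `pairRad L X i j n = |xᵢ - xⱼ - Ln|`, the
hard layers `hardLayer v L s` and the transition zones `hardZone v L s` behave under lattice translations (they are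
`(Lℤ³)^N`-periodic, so they live on the torus `(ℝ/ℤ)^{3N}` through `fromUnitTorusN L`), along the coordinate lines
`X + τ 𝐞_{i,k}` (the radius of the moving pair is `|y + τ e_k|`, `y = xᵢ - xⱼ - Ln`), and under the covering map
(`toUnitTorusN L ((Lx) 𝐞_{i,k}) = x 𝐞_{(i,k)}`, so Config lines are torus lines); measurability of layers and zones; one
image-pair term is dominated by the periodic interaction.

Tagged folklore.
-/

noncomputable section

open MeasureTheory Set Metric
open scoped ENNReal

namespace Literature.MathematicalPhysics.QuantumManyBody.BoseGas

variable {N : ℕ} {L : ℝ} {v : ℝ → ℝ≥0∞}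

/-! ### Lattice translations -/

/-- Pair-image radii under a lattice translation: the image index is shifted,
`pairRad L (X + L m) i j n = pairRad L X i j (n - mᵢ + mⱼ)`. [folklore] -/
theorem pairRad_add_latticeVecN (L : ℝ) (X : Config N) (m : Fin N → Fin 3 → ℤ) (i j : Fin N) (n : Fin 3 → ℤ) :
    pairRad L (X + latticeVecN L m) i j n = pairRad L X i j (n - m i + m j) := by
  simp only [pairRad]
  congr 1
  ext k
  simp only [PiLp.sub_apply, Pi.add_apply, PiLp.add_apply, latticeVecN_apply, latticeVec_apply, Pi.sub_apply,
    Int.cast_add, Int.cast_sub]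
  ring

/-- The hard layers are lattice periodic. [folklore] -/
theorem add_latticeVecN_mem_hardLayer_iff (X : Config N) (m : Fin N → Fin 3 → ℤ) (s : ℝ) :
    X + latticeVecN L m ∈ (hardLayer v L s : Set (Config N)) ↔ X ∈ hardLayer v L s := by
  constructor
  · rintro ⟨i, j, n, hij, h⟩
    exact ⟨i, j, n - m i + m j, hij, by rwa [pairRad_add_latticeVecN] at h⟩
  · rintro ⟨i, j, n, hij, h⟩
    refine ⟨i, j, n + m i - m j, hij, ?_⟩
    rwa [pairRad_add_latticeVecN, show n + m i - m j - m i + m j = n by abel]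

/-- The transition zones are lattice periodic. [folklore] -/
theorem add_latticeVecN_mem_hardZone_iff (X : Config N) (m : Fin N → Fin 3 → ℤ) (s : ℝ) :
    X + latticeVecN L m ∈ (hardZone v L s : Set (Config N)) ↔ X ∈ hardZone v L s := by
  constructor
  · rintro ⟨i, j, n, hij, h0, h⟩
    exact ⟨i, j, n - m i + m j, hij, by rwa [pairRad_add_latticeVecN] at h0, by rwa [pairRad_add_latticeVecN] at h⟩
  · rintro ⟨i, j, n, hij, h0, h⟩
    refine ⟨i, j, n + m i - m j, hij, ?_, ?_⟩
    · rwa [pairRad_add_latticeVecN, show n + m i - m j - m i + m j = n by abel]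
    · rwa [pairRad_add_latticeVecN, show n + m i - m j - m i + m j = n by abel]

/-- The hard layers are torus periodic (as `Prop`-valued functions). [folklore] -/
theorem isTorusPeriodic_mem_hardLayer (v : ℝ → ℝ≥0∞) (L s : ℝ) :
    IsTorusPeriodic L (fun X : Config N => X ∈ (hardLayer v L s : Set (Config N))) := by
  intro X i k
  rw [single_single_eq_latticeVecN]
  exact propext (add_latticeVecN_mem_hardLayer_iff X _ s)

/-- The transition zones are torus periodic (as `Prop`-valued functions). [folklore] -/
theorem isTorusPeriodic_mem_hardZone (v : ℝ → ℝ≥0∞) (L s : ℝ) :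
    IsTorusPeriodic L (fun X : Config N => X ∈ (hardZone v L s : Set (Config N))) := by
  intro X i k
  rw [single_single_eq_latticeVecN]
  exact propext (add_latticeVecN_mem_hardZone_iff X _ s)

/-- The periodic interaction is torus periodic. [folklore] -/
theorem isTorusPeriodic_periodicInteraction (v : ℝ → ℝ≥0∞) (L : ℝ) :
    IsTorusPeriodic L (periodicInteraction (N := N) v L) := by
  intro X i k
  rw [single_single_eq_latticeVecN]
  set m : Fin N → Fin 3 → ℤ := Pi.single i (Pi.single k 1)
  unfold periodicInteraction periodizedPotential
  refine Finset.sum_congr rfl fun a _ => Finset.sum_congr rfl fun b _ => ?_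
  have h := fun n => pairRad_add_latticeVecN L X m a b n
  simp only [pairRad] at h
  simp only [h]
  exact (Equiv.tsum_eq (((Equiv.subRight (m a)).trans (Equiv.addRight (m b)))) fun n => v ‖X a - X b - latticeVec L n‖)

/-- **A periodic function along a torus line is the function along the Config line**: for torus-periodic `F`,
`F(fromUnitTorusN L (t + toUnitTorusN L H)) = F(fromUnitTorusN L t + H)`. [folklore] -/
theorem IsTorusPeriodic.apply_fromUnitTorusN_add (hL : 0 < L) {E : Type*} {F : Config N → E}
    (hF : IsTorusPeriodic L F) (t : UnitAddTorus (Fin N × Fin 3)) (H : Config N) :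
    F (fromUnitTorusN L (t + toUnitTorusN L H)) = F (fromUnitTorusN L t + H) := by
  obtain ⟨m, hm⟩ := exists_fromUnitTorusN_toUnitTorusN_eq hL (fromUnitTorusN L t + H)
  rw [toUnitTorusN_add, toUnitTorusN_fromUnitTorusN hL.ne'] at hm
  rw [hm, hF.add_latticeVecN]

/-- The covering map on a scaled coordinate generator: `toUnitTorusN L ((Lx) 𝐞_{i,k}) = x 𝐞_{(i,k)}`. [folklore] -/
theorem toUnitTorusN_smul_single (hL : L ≠ 0) (i : Fin N) (k : Fin 3) (x : ℝ) :
    toUnitTorusN L ((L * x) • (Pi.single i (EuclideanSpace.single k (1 : ℝ)) : Config N)) =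
      Pi.single (i, k) ((x : ℝ) : UnitAddCircle) := by
  funext p
  rw [toUnitTorusN_apply]
  rcases eq_or_ne p (i, k) with rfl | hp
  · rw [Pi.single_eq_same]
    simp only [Pi.smul_apply, Pi.single_eq_same, PiLp.smul_apply, PiLp.single_apply, if_true, smul_eq_mul, mul_one]
    rw [mul_div_cancel_left₀ _ hL]
  · rw [Pi.single_eq_of_ne hp]
    have : ((L * x) • (Pi.single i (EuclideanSpace.single k (1 : ℝ)) : Config N)) p.1 p.2 = 0 := by
      simp only [Pi.smul_apply, PiLp.smul_apply, smul_eq_mul]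
      rcases eq_or_ne p.1 i with h1 | h1
      · have h2 : p.2 ≠ k := fun h2 => hp (Prod.ext h1 h2)
        rw [h1, Pi.single_eq_same, PiLp.single_apply, if_neg h2, mul_zero]
      · rw [Pi.single_eq_of_ne h1]
        simp
    rw [this, zero_div]
    rfl

/-! ### Along coordinate lines -/

/-- The moving pair seen from the moving particle: `pairRad L (X + τ𝐞_{i,k}) i j n = |(xᵢ - xⱼ - Ln) + τ e_k|`.
[folklore] -/
theorem pairRad_add_smul_single_left (L : ℝ) (X : Config N) {i j : Fin N} (hij : i ≠ j) (k : Fin 3)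
    (n : Fin 3 → ℤ) (τ : ℝ) :
    pairRad L (X + τ • (Pi.single i (EuclideanSpace.single k (1 : ℝ)) : Config N)) i j n =
      ‖(X i - X j - latticeVec L n) + τ • EuclideanSpace.single k (1 : ℝ)‖ := by
  simp only [pairRad, Pi.add_apply, Pi.smul_apply, Pi.single_eq_same, Pi.single_eq_of_ne hij.symm, smul_zero, add_zero]
  congr 1
  abel

/-- The moving pair seen from the resting particle: `pairRad L (X + τ𝐞_{i,k}) j i n = |(xⱼ - xᵢ - Ln) + (-τ) e_k|`.
[folklore] -/
theorem pairRad_add_smul_single_right (L : ℝ) (X : Config N) {i j : Fin N} (hij : i ≠ j) (k : Fin 3)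
    (n : Fin 3 → ℤ) (τ : ℝ) :
    pairRad L (X + τ • (Pi.single i (EuclideanSpace.single k (1 : ℝ)) : Config N)) j i n =
      ‖(X j - X i - latticeVec L n) + (-τ) • EuclideanSpace.single k (1 : ℝ)‖ := by
  simp only [pairRad, Pi.add_apply, Pi.smul_apply, Pi.single_eq_same, Pi.single_eq_of_ne hij.symm, smul_zero, add_zero,
    neg_smul]
  congr 1
  abel

/-- Pairs not involving the moving particle keep their radii. [folklore] -/
theorem pairRad_add_smul_single_of_ne (L : ℝ) (X : Config N) {i a b : Fin N} (ha : a ≠ i) (hb : b ≠ i) (k : Fin 3)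
    (n : Fin 3 → ℤ) (τ : ℝ) :
    pairRad L (X + τ • (Pi.single i (EuclideanSpace.single k (1 : ℝ)) : Config N)) a b n = pairRad L X a b n := by
  simp only [pairRad, Pi.add_apply, Pi.smul_apply, Pi.single_eq_of_ne ha, Pi.single_eq_of_ne hb, smul_zero, add_zero]

/-! ### Measurability and domination -/

/-- The pair-image radii are continuous. [folklore] -/
theorem continuous_pairRad (L : ℝ) (i j : Fin N) (n : Fin 3 → ℤ) : Continuous fun X : Config N => pairRad L X i j n := by
  unfold pairRad; fun_prop

/-- The hard layers are measurable. [folklore] -/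
theorem measurableSet_hardLayer (v : ℝ → ℝ≥0∞) (L s : ℝ) : MeasurableSet (hardLayer v L s : Set (Config N)) := by
  have h : (hardLayer v L s : Set (Config N)) =
      ⋃ i : Fin N, ⋃ j : Fin N, ⋃ n : Fin 3 → ℤ, {X | i ≠ j ∧ infDist (pairRad L X i j n) (hardRad v) ≤ s} := by
    ext X; simp only [hardLayer, mem_setOf_eq, mem_iUnion]
  rw [h]
  refine MeasurableSet.iUnion fun i => MeasurableSet.iUnion fun j => MeasurableSet.iUnion fun n => ?_
  by_cases hij : i = j
  · simp [hij]
  · simp only [hij, not_false_eq_true, true_and, ne_eq]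
    exact measurableSet_le ((continuous_infDist_pt _).measurable.comp (continuous_pairRad L i j n).measurable)
      measurable_const

/-- The transition zones are measurable. [folklore] -/
theorem measurableSet_hardZone (v : ℝ → ℝ≥0∞) (L s : ℝ) : MeasurableSet (hardZone v L s : Set (Config N)) := by
  have h : (hardZone v L s : Set (Config N)) = ⋃ i : Fin N, ⋃ j : Fin N, ⋃ n : Fin 3 → ℤ,
      {X | i ≠ j ∧ 0 < infDist (pairRad L X i j n) (hardRad v) ∧ infDist (pairRad L X i j n) (hardRad v) ≤ 3 * s} := by
    ext X; simp only [hardZone, mem_setOf_eq, mem_iUnion]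
  rw [h]
  refine MeasurableSet.iUnion fun i => MeasurableSet.iUnion fun j => MeasurableSet.iUnion fun n => ?_
  by_cases hij : i = j
  · simp [hij]
  · simp only [hij, not_false_eq_true, true_and, ne_eq]
    have hm : Measurable fun X : Config N => infDist (pairRad L X i j n) (hardRad v) :=
      (continuous_infDist_pt _).measurable.comp (continuous_pairRad L i j n).measurable
    exact (measurableSet_lt measurable_const hm).inter (measurableSet_le hm measurable_const)

/-- One image-pair term is dominated by the periodic interaction: for `i ≠ j` and every lattice image `n`,
`w(pairRad L X i j n) ≤ W(X)` (for `j < i` pass to the pair `(j, i)` and the image `-n`). [folklore] -/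
theorem apply_pairRad_le_periodicInteraction (w : ℝ → ℝ≥0∞) (L : ℝ) (X : Config N) {i j : Fin N} (hij : i ≠ j)
    (n : Fin 3 → ℤ) : w (pairRad L X i j n) ≤ periodicInteraction w L X := by
  have key : ∀ {i j : Fin N}, i < j → ∀ n : Fin 3 → ℤ,
      w ‖X i - X j - latticeVec L n‖ ≤ periodicInteraction w L X := by
    intro i j h n
    unfold periodicInteraction
    calc w ‖X i - X j - latticeVec L n‖ ≤ periodizedPotential w L (X i - X j) := by
          unfold periodizedPotential; exact ENNReal.le_tsum n
      _ ≤ ∑ j' : Fin N with i < j', periodizedPotential w L (X i - X j') :=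
          Finset.single_le_sum (f := fun j' => periodizedPotential w L (X i - X j'))
            (fun _ _ => zero_le) (Finset.mem_filter.2 ⟨Finset.mem_univ _, h⟩)
      _ ≤ ∑ i' : Fin N, ∑ j' : Fin N with i' < j', periodizedPotential w L (X i' - X j') :=
          Finset.single_le_sum (f := fun i' => ∑ j' : Fin N with i' < j', periodizedPotential w L (X i' - X j'))
            (fun _ _ => zero_le) (Finset.mem_univ _)
  unfold pairRad
  rcases lt_or_gt_of_ne hij with h | h
  · exact key h n
  · rw [show ‖X i - X j - latticeVec L n‖ = ‖X j - X i - latticeVec L (-n)‖ by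
      rw [← norm_neg]; congr 1; ext k; simp [latticeVec_apply]; ring]
    exact key h (-n)

end Literature.MathematicalPhysics.QuantumManyBody.BoseGas

end
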